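import Literature.FieldTheory.AlgClosed.PuiseuxEtaleShift
import Literature.FieldTheory.AlgClosed.PuiseuxImplicitRoot
import Literature.FieldTheory.AlgClosed.PuiseuxAnalyticBranchesAux
import Mathlib.Analysis.Analytic.IsolatedZeros
import HarnessLib

/-!
# Analytic Puiseux branches: all roots of `F(s, ·)` near `s = 0` as holomorphic germs

Topic `Literature/FieldTheory/AlgClosed` (convergence half of Puiseux's theorem, complex-analytic step).
Let `K → ℂ` be an embedded field and `F ∈ K[s][Y]` a polynomial which factors over `K⟦s⟧` as
`F = c · ∏_{v ∈ S} (Y − v)` with `c ∈ K[s] ∖ {0}` and `S` a finite set of DISTINCT formal power series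
roots (the output of `PuiseuxFormalBranches.lean` after ramification and pole clearing). Then for every
`N₀` each formal root `v` is realised by a HOLOMORPHIC germ: there are `N_v ≥ N₀`, functions `ρ_v`
analytic on a common disc `|s| < r`, such that
`Y_v(s) := T_v(s) + s^{N_v} ρ_v(s)`, `T_v = ` the truncation of `v` below degree `N_v`,
satisfies `F(s, Y_v(s)) = 0` on the disc, and for `0 < |s| < r` the values `Y_v(s)`, `v ∈ S`, are ALL the
roots of `F(s, ·)`, and they are pairwise distinct. Proof: étale Taylor shift of each simple formal root (`exists_etaleShift`), holomorphic
implicit function theorem at the resulting étale point (`exists_holomorphic_root`), distinctness of the germs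
from distinct truncations (Taylor coefficients below `N_v`), and root counting. No comparison between the
Taylor series of `Y_v` and `v` is needed (nor claimed) beyond the truncation.

## Main statements

* `Literature.FieldTheory.AlgClosed.exists_analyticBranches`: the statement above.

## References

* J. Kollár, *Lectures on Resolution of Singularities* (2007), Thm. 1.94–1.95 (Puiseux; convergence).
  [Kollar2007]
* J. Bochnak, M. Coste, M.-F. Roy, *Real Algebraic Geometry* (1998), §8.1. [BochnakCosteRoy1998]
-/

noncomputable section

namespace Literature.FieldTheory.AlgClosed

open Polynomial Filter Topology
open scoped PowerSeries

variable {K : Type*} [Field K] [Algebra K ℂ]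

/-- A polynomial over an embedded field whose complex evaluation vanishes identically near `0` is zero.
[folklore] -/
theorem map_eq_zero_of_eventually_eval_eq_zero (p : K[X])
    (h : ∀ᶠ s in 𝓝 (0 : ℂ), (p.map (algebraMap K ℂ)).eval s = 0) : p = 0 := by
  have hq : p.map (algebraMap K ℂ) = 0 := by
    ext k
    have hk := (Filter.EventuallyEq.iteratedDeriv_eq k (h : (fun s => (p.map (algebraMap K ℂ)).eval s) =ᶠ[𝓝 0]
      fun _ => (0 : ℂ)))
    rw [iteratedDeriv_polynomial_eval_zero, iteratedDeriv_const] at hk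
    simpa [Nat.factorial_ne_zero] using hk
  exact (Polynomial.map_eq_zero_iff (algebraMap K ℂ).injective).mp hq

/-- **Analytic Puiseux branches.** See the module docstring. [cite: Kollar2007, Thm. 1.94–1.95] -/
theorem exists_analyticBranches (F : K[X][X]) (lc : K[X]) (S : Finset K⟦X⟧) (hlc : lc ≠ 0)
    (hF : F.map (Polynomial.coeToPowerSeries.ringHom : K[X] →+* K⟦X⟧) =
      Polynomial.C (lc : K⟦X⟧) * ∏ v ∈ S, (Polynomial.X - Polynomial.C v)) (N₀ : ℕ) :
    ∃ (Nv : K⟦X⟧ → ℕ) (ρ : K⟦X⟧ → ℂ → ℂ) (r : ℝ), 0 < r ∧ (∀ v ∈ S, N₀ ≤ Nv v) ∧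
      (∀ v ∈ S, ∀ s ∈ Metric.ball (0 : ℂ) r, AnalyticAt ℂ (ρ v) s) ∧
      (∀ v ∈ S, ∀ s ∈ Metric.ball (0 : ℂ) r,
        (F.map (Polynomial.eval₂RingHom (algebraMap K ℂ) s)).eval
          (Polynomial.eval₂ (algebraMap K ℂ) s (PowerSeries.trunc (Nv v) v) + s ^ Nv v * ρ v s) = 0) ∧
      (∀ s ∈ Metric.ball (0 : ℂ) r, s ≠ 0 → ∀ W : ℂ,
        (F.map (Polynomial.eval₂RingHom (algebraMap K ℂ) s)).eval W = 0 →
        ∃ v ∈ S, W = Polynomial.eval₂ (algebraMap K ℂ) s (PowerSeries.trunc (Nv v) v) + s ^ Nv v * ρ v s) ∧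
      (∀ s ∈ Metric.ball (0 : ℂ) r, s ≠ 0 → ∀ v ∈ S, ∀ v' ∈ S, v ≠ v' →
        Polynomial.eval₂ (algebraMap K ℂ) s (PowerSeries.trunc (Nv v) v) + s ^ Nv v * ρ v s ≠
          Polynomial.eval₂ (algebraMap K ℂ) s (PowerSeries.trunc (Nv v') v') + s ^ Nv v' * ρ v' s) := by
  classical
  set ι₀ : K[X] →+* K⟦X⟧ := Polynomial.coeToPowerSeries.ringHom with hι₀
  set alg : K →+* ℂ := algebraMap K ℂ with halg
  have hι₀inj : Function.Injective ι₀ := Polynomial.coe_injective K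
  have hlc' : (lc : K⟦X⟧) ≠ 0 := by
    rw [Ne, ← Polynomial.coe_zero, Polynomial.coe_inj]; exact hlc
  -- degree and leading coefficient of `F`
  have hmonic : (∏ v ∈ S, (Polynomial.X - Polynomial.C v) : K⟦X⟧[X]).Monic :=
    Polynomial.monic_prod_of_monic _ _ fun v _ => Polynomial.monic_X_sub_C v
  have hlcF : F.leadingCoeff = lc := by
    apply hι₀inj
    rw [← Polynomial.leadingCoeff_map_of_injective hι₀inj, hF, Polynomial.leadingCoeff_mul,
      Polynomial.leadingCoeff_C, hmonic.leadingCoeff, mul_one]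
    rfl
  have hdegF : F.natDegree = S.card := by
    rw [← Polynomial.natDegree_map_eq_of_injective hι₀inj, hF, Polynomial.natDegree_C_mul hlc',
      Polynomial.natDegree_prod _ _ fun v _ => Polynomial.X_sub_C_ne_zero v]
    simp
  -- Step 1: every `v ∈ S` is a simple formal root
  have hroot : ∀ v ∈ S, (F.map ι₀).eval v = 0 := fun v hv => by
    rw [hF]; exact eval_C_mul_prod_X_sub_C_eq_zero _ S hv
  have hsimple : ∀ v ∈ S, (Polynomial.derivative (F.map ι₀)).eval v ≠ 0 := fun v hv => by
    rw [hF]; exact eval_derivative_prod_ne_zero hlc' S hv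
  -- Step 2: a distinguishing index
  obtain ⟨N₁, hN₁⟩ := exists_index_coeff_ne S
  -- Step 3: the étale shift of every root, with `N_v ≥ max N₀ N₁`
  have hshift : ∀ v : K⟦X⟧, ∃ (N e : ℕ) (G : K[X][X]), v ∈ S →
      (max N₀ N₁ ≤ N ∧
        F.comp (Polynomial.C (PowerSeries.trunc N v) + Polynomial.C ((X : K[X]) ^ N) * Polynomial.X) =
          Polynomial.C ((X : K[X]) ^ e) * G ∧
        (G.map (Polynomial.evalRingHom 0)).eval (PowerSeries.coeff N v) = 0 ∧
        (Polynomial.derivative (G.map (Polynomial.evalRingHom 0))).eval (PowerSeries.coeff N v) ≠ 0) := by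
    intro v
    by_cases hv : v ∈ S
    · obtain ⟨N, e, G, h1, h2, h3, h4⟩ := exists_etaleShift F v (hroot v hv) (hsimple v hv) (max N₀ N₁)
      exact ⟨N, e, G, fun _ => ⟨h1, h2, h3, h4⟩⟩
    · exact ⟨0, 0, 0, fun h => absurd h hv⟩
  choose Nv ev G hG using hshift
  -- Step 4: the holomorphic root of every shifted equation at its étale point
  have hhol : ∀ v : K⟦X⟧, ∃ ρ : ℂ → ℂ, v ∈ S →
      (ρ 0 = alg (PowerSeries.coeff (Nv v) v) ∧ AnalyticAt ℂ ρ 0 ∧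
        ∀ᶠ s in 𝓝 (0 : ℂ), ((G v).map (Polynomial.eval₂RingHom alg s)).eval (ρ s) = 0) := by
    intro v
    by_cases hv : v ∈ S
    · obtain ⟨_, hcomp, h0, h1⟩ := hG v hv
      have h0' : ((G v).map (Polynomial.eval₂RingHom alg 0)).eval (alg (PowerSeries.coeff (Nv v) v)) = 0 := by
        rw [halg, eval_map_eval₂RingHom_zero, h0, map_zero]
      have h1' : ((Polynomial.derivative (G v)).map (Polynomial.eval₂RingHom alg 0)).eval
          (alg (PowerSeries.coeff (Nv v) v)) ≠ 0 := by
        rw [halg, eval_map_eval₂RingHom_zero, ← Polynomial.derivative_map]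
        exact (map_ne_zero_iff _ (algebraMap K ℂ).injective).mpr h1
      obtain ⟨ρ, hρ0, hρan, hρeq⟩ := exists_holomorphic_root (G v) h0' h1'
      exact ⟨ρ, fun _ => ⟨hρ0, hρan, hρeq⟩⟩
    · exact ⟨fun _ => 0, fun h => absurd h hv⟩
  choose ρ hρ using hhol
  -- the branches
  set Y : K⟦X⟧ → ℂ → ℂ := fun v s =>
    Polynomial.eval₂ alg s (PowerSeries.trunc (Nv v) v) + s ^ Nv v * ρ v s with hY
  have hYan : ∀ v ∈ S, AnalyticAt ℂ (Y v) 0 := by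
    intro v hv
    have h1 : AnalyticAt ℂ (fun s : ℂ => Polynomial.eval₂ alg s (PowerSeries.trunc (Nv v) v)) 0 := by
      have := (AnalyticOnNhd.eval_polynomial (𝕜 := ℂ) ((PowerSeries.trunc (Nv v) v).map alg)) 0 (Set.mem_univ _)
      simpa [Polynomial.eval_map] using this
    exact h1.add ((analyticAt_id.pow _).mul (hρ v hv).2.1)
  -- Step 5a: distinct germs
  have hdist : ∀ v ∈ S, ∀ v' ∈ S, v ≠ v' → ∀ᶠ s in 𝓝 (0 : ℂ), s ≠ 0 → Y v s ≠ Y v' s := by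
    intro v hv v' hv' hne
    obtain ⟨i, hiN₁, hi⟩ := hN₁ v hv v' hv' hne
    have hiv : i < Nv v := lt_of_lt_of_le hiN₁ ((le_max_right _ _).trans (hG v hv).1)
    have hiv' : i < Nv v' := lt_of_lt_of_le hiN₁ ((le_max_right _ _).trans (hG v' hv').1)
    have hD : AnalyticAt ℂ (fun s => Y v s - Y v' s) 0 := (hYan v hv).sub (hYan v' hv')
    have hderY : ∀ w ∈ S, i < Nv w →
        iteratedDeriv i (Y w) 0 = (i.factorial : ℂ) * alg (PowerSeries.coeff i w) := by
      intro w hw hiw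
      have hfun : Y w = fun s => ((PowerSeries.trunc (Nv w) w).map alg).eval s + s ^ Nv w * ρ w s := by
        funext s; simp [hY, Polynomial.eval_map]
      rw [hfun, iteratedDeriv_shiftedBranch_zero (hρ w hw).2.1 _ hiw, Polynomial.coeff_map,
        coeff_trunc_of_lt hiw]
    have hnot : ¬ (∀ᶠ s in 𝓝 (0 : ℂ), Y v s - Y v' s = 0) := by
      intro hzero
      have h1 := Filter.EventuallyEq.iteratedDeriv_eq i
        (hzero : (fun s => Y v s - Y v' s) =ᶠ[𝓝 0] fun _ => (0 : ℂ))
      rw [iteratedDeriv_const, ite_self] at h1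
      have h2 : iteratedDeriv i (fun s => Y v s - Y v' s) 0 =
          iteratedDeriv i (Y v) 0 - iteratedDeriv i (Y v') 0 := by
        have ha : ContDiffAt ℂ i (Y v) 0 := (hYan v hv).contDiffAt.of_le le_top
        have hb : ContDiffAt ℂ i (Y v') 0 := (hYan v' hv').contDiffAt.of_le le_top
        exact iteratedDeriv_sub ha hb
      rw [h2, hderY v hv hiv, hderY v' hv' hiv', ← mul_sub, ← map_sub] at h1
      rcases mul_eq_zero.mp h1 with h3 | h3
      · exact Nat.factorial_ne_zero i (by exact_mod_cast h3)
      · exact hi (sub_eq_zero.mp ((map_eq_zero_iff alg (algebraMap K ℂ).injective).mp h3))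
    rcases hD.eventually_eq_zero_or_eventually_ne_zero with hz | hnz
    · exact absurd hz hnot
    · rw [eventually_nhdsWithin_iff] at hnz
      filter_upwards [hnz] with s hs hs0
      exact sub_ne_zero.mp (hs hs0)
  -- Step 5b: the leading coefficient does not vanish for small `s ≠ 0`
  have hlcev : ∀ᶠ s in 𝓝 (0 : ℂ), s ≠ 0 → Polynomial.eval₂ alg s lc ≠ 0 := by
    have han : AnalyticAt ℂ (fun s : ℂ => Polynomial.eval₂ alg s lc) 0 := by
      have := (AnalyticOnNhd.eval_polynomial (𝕜 := ℂ) (lc.map alg)) 0 (Set.mem_univ _)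
      simpa [Polynomial.eval_map] using this
    rcases han.eventually_eq_zero_or_eventually_ne_zero with hz | hnz
    · exfalso
      apply hlc
      refine map_eq_zero_of_eventually_eval_eq_zero lc ?_
      filter_upwards [hz] with s hs
      simpa [Polynomial.eval_map] using hs
    · rw [eventually_nhdsWithin_iff] at hnz
      exact hnz
  -- Step 5c: a common radius
  have hall : ∀ᶠ s in 𝓝 (0 : ℂ),
      (∀ v ∈ S, AnalyticAt ℂ (ρ v) s ∧ ((G v).map (Polynomial.eval₂RingHom alg s)).eval (ρ v s) = 0) ∧
      (∀ p ∈ S ×ˢ S, p.1 ≠ p.2 → s ≠ 0 → Y p.1 s ≠ Y p.2 s) ∧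
      (s ≠ 0 → Polynomial.eval₂ alg s lc ≠ 0) := by
    refine ((Filter.eventually_all_finset S).mpr fun v hv => ?_).and
      (((Filter.eventually_all_finset (S ×ˢ S)).mpr fun p hp => ?_).and hlcev)
    · exact ((hρ v hv).2.1.eventually_analyticAt).and (hρ v hv).2.2
    · obtain ⟨hp1, hp2⟩ := Finset.mem_product.mp hp
      by_cases hne : p.1 = p.2
      · exact Filter.Eventually.of_forall fun s h => absurd hne h
      · filter_upwards [hdist p.1 hp1 p.2 hp2 hne] with s hs _ hs0
        exact hs hs0
  obtain ⟨r, hr, hball⟩ := Metric.eventually_nhds_iff_ball.mp hall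
  refine ⟨Nv, ρ, r, hr, fun v hv => (le_max_left _ _).trans (hG v hv).1,
    fun v hv s hs => ((hball s hs).1 v hv).1, fun v hv s hs => ?_, fun s hs hs0 W hW => ?_,
    fun s hs hs0 v hv v' hv' hne => (hball s hs).2.1 (v, v') (Finset.mem_product.mpr ⟨hv, hv'⟩) hne hs0⟩
  · -- the branch is a root: `F(s, T + s^N ρ) = s^e · G(s, ρ) = 0`
    rw [eval_shift_of_comp_eq _ _ _ _ _ (hG v hv).2.1, ((hball s hs).1 v hv).2, mul_zero]
  · -- exhaustion by counting
    set ps : ℂ[X] := F.map (Polynomial.eval₂RingHom alg s) with hps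
    have hlcs : (Polynomial.eval₂RingHom alg s) F.leadingCoeff ≠ 0 := by
      rw [hlcF, Polynomial.coe_eval₂RingHom]
      exact (hball s hs).2.2 hs0
    have hdeg : ps.natDegree = S.card := by
      rw [hps, Polynomial.natDegree_map_of_leadingCoeff_ne_zero _ hlcs, hdegF]
    have hps0 : ps ≠ 0 := fun h => by
      have := congrArg Polynomial.leadingCoeff h
      rw [hps, Polynomial.leadingCoeff_map_of_leadingCoeff_ne_zero _ hlcs, Polynomial.leadingCoeff_zero] at this
      exact hlcs this
    have hinj : Set.InjOn (fun v => Y v s) (S : Set K⟦X⟧) := by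
      intro v hv v' hv' hYY
      by_contra hne
      exact (hball s hs).2.1 (v, v') (Finset.mem_product.mpr ⟨hv, hv'⟩) hne hs0 hYY
    have hsub : S.image (fun v => Y v s) ⊆ ps.roots.toFinset := by
      intro W' hW'
      obtain ⟨v, hv, rfl⟩ := Finset.mem_image.mp hW'
      rw [Multiset.mem_toFinset, Polynomial.mem_roots hps0, Polynomial.IsRoot.def, hps,
        eval_shift_of_comp_eq _ _ _ _ _ (hG v hv).2.1, ((hball s hs).1 v hv).2, mul_zero]
    by_contra hWnot
    have hWmem : W ∈ ps.roots.toFinset := by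
      rw [Multiset.mem_toFinset, Polynomial.mem_roots hps0, Polynomial.IsRoot.def]; exact hW
    have hWnot' : W ∉ S.image (fun v => Y v s) := by
      intro h
      obtain ⟨v, hv, hvW⟩ := Finset.mem_image.mp h
      exact hWnot ⟨v, hv, hvW.symm⟩
    have h1 : (insert W (S.image fun v => Y v s)).card ≤ ps.roots.toFinset.card :=
      Finset.card_le_card (Finset.insert_subset hWmem hsub)
    rw [Finset.card_insert_of_notMem hWnot', Finset.card_image_of_injOn hinj] at h1
    have h2 : ps.roots.toFinset.card ≤ S.card :=
      (Multiset.toFinset_card_le _).trans ((Polynomial.card_roots' ps).trans hdeg.le)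
    omega

end Literature.FieldTheory.AlgClosed

end
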